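import Summits.AnomalousDissipation.AnomalousDissipation.Theorems.IsotropicCubatureWord
import HarnessLib

/-!
# K2R `RealisedQuasiStaticCellLaw`, line `floquet-bloch`, stub `stub_lowSectorDecay` (S1D): cubature moments of the 26-slot word

Summits-side helper (everything proved; no definitions, no named facts; `--supports stmt-AnomalousDissipation-20446`).
Brick (F1) of the S1D stub plan (cell `ad-ideate`, planner ad-p1 gen 15, `STUB-PLAN-stub_lowSectorDecay.md` §3.4):
the FAR-sector argument needs, for every large-scale wave-vector `q ≠ 0`, ONE slot `j` of the cubature word
`Theorems.cubatureWord` whose polarisation `ê_j` AND direction `m̂_j` both see `q` at a fixed positive angle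
(`|q̂·ê_j| ≥ 0.23`, `|q̂·m̂_j| ≥ 0.23`). This is a pigeonhole over the 26 slots once one knows the exact degree-2 and
degree-4 CUBATURE MOMENTS of the slot table `Theorems.slots` (`τ_j = c_j |m_j|⁴`, `c = 40 : 32 : 27`):

* `slots_secondMoment_sum`:  `S₂(q) := Σ_j τ_j (v_j·q)² / (n_j |m_j|⁴) = 280 |q|²`;
* `slots_fourthMoment_sum`:  `S₄(q) := Σ_j τ_j (v_j·q)² (q·m_j)² / (n_j |m_j|⁶) = 56 |q|⁴`;
* `slots_sixthMoment_sum`:   `S₆(q) := Σ_j τ_j (v_j·q)² (q·m_j)⁴ / (n_j |m_j|⁸) = 24 |q|⁶`.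

These are the `p := 0` and `p := q` specialisations of the landed polynomial identity `slotTerm_sum`
(`Σ_j slotTerm (slots j) q p = (280|q|² − 112|q|²|p|² + 56(p·q)²)/(32π⁴)`): `slotTerm d q 0 = S₂-term/(32π⁴)` and
`slotTerm d q q = (S₂-term − S₄-term)/(32π⁴)`; here they are re-derived by the same `Fin 26` expansion (`ring`), which also
gives `S₆`. Consequences:

* `slots_exists_goodSlot`: `∃ j, (28/13)|q|⁴ ≤ τ_j (v_j·q)²(q·m_j)²/(n_j|m_j|⁶)` (pigeonhole, `56/26 = 28/13`);
* `cubatureWord_exists_goodPhase`: in the language of the word's phases (`ê_j = v_j/√n_j`, `m_j`):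
  `∃ j, (28/13)‖q‖⁴‖m_j‖⁶ ≤ τ_j ⟪ê_j, q⟫² ⟪m_j, q⟫²`, and since `τ_j ≤ 40‖m_j‖⁴` and each factor is at most its
  Cauchy–Schwarz bound, `(7/130)‖q‖² ≤ ⟪ê_j, q⟫²` and `(7/130)‖q‖²‖m_j‖² ≤ ⟪m_j, q⟫²` (`√(7/130) = 0.232…`).

Also recorded: the slot table facts the S1D bookkeeping quotes (`‖m_j‖² ∈ {1,2,3}`, `τ_j ∈ {40,128,243}`,
`27‖m_j‖⁴ ≤ τ_j ≤ 40‖m_j‖⁴`) and the invariance of `e`, `m` under `LatticeWord.stretch` (slot durations scale, phases do not).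
Finite-dimensional real algebra only.
-/

set_option linter.dupNamespace false -- layout D-0017: `AnomalousDissipation.AnomalousDissipation` repeats by design

namespace Summit.AnomalousDissipation.AnomalousDissipation.Theorems

noncomputable section

open Literature.Analysis Literature.Analysis.FunctionSpaces Literature.Analysis.FluidPDE
open Literature.Analysis.FluidPDE.LatticeShear
open scoped InnerProductSpace Real
open Literature.Algebra.EuclideanLattices (inner_fin_three norm_sq_fin_three)

/-! ## The three cubature moment identities of the slot table (coordinates) -/

/-- **S₂.** The degree-2 cubature moment of the 26 slots: `Σ_j τ_j (v_j·q)² / (n_j |m_j|⁴) = 280 |q|²` for every `q`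
(the `p := 0` specialisation of `slotTerm_sum`, times `32π⁴`). -/
theorem slots_secondMoment_sum (q : EuclideanSpace ℝ (Fin 3)) :
    ∑ j, ((slots j).τ : ℝ) * (((slots j).v 0 : ℝ) * q 0 + (slots j).v 1 * q 1 + (slots j).v 2 * q 2) ^ 2 /
        ((slots j).n * (((slots j).m 0 : ℝ) ^ 2 + (slots j).m 1 ^ 2 + (slots j).m 2 ^ 2) ^ 2) =
      280 * (q 0 ^ 2 + q 1 ^ 2 + q 2 ^ 2) := by
  simp only [Fin.sum_univ_succ, Fin.sum_univ_zero, slots, Matrix.cons_val_zero, Matrix.cons_val_succ,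
    Matrix.cons_val_one, Matrix.head_cons, Matrix.cons_val_two, Matrix.tail_cons]
  push_cast
  field_simp
  ring

/-- **S₄.** The degree-4 cubature moment of the 26 slots: `Σ_j τ_j (v_j·q)² (q·m_j)² / (n_j |m_j|⁶) = 56 |q|⁴` for every
`q` (the `p := q` specialisation of `slotTerm_sum` combined with `S₂`). -/
theorem slots_fourthMoment_sum (q : EuclideanSpace ℝ (Fin 3)) :
    ∑ j, ((slots j).τ : ℝ) * (((slots j).v 0 : ℝ) * q 0 + (slots j).v 1 * q 1 + (slots j).v 2 * q 2) ^ 2 *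
        (q 0 * (slots j).m 0 + q 1 * (slots j).m 1 + q 2 * (slots j).m 2) ^ 2 /
        ((slots j).n * (((slots j).m 0 : ℝ) ^ 2 + (slots j).m 1 ^ 2 + (slots j).m 2 ^ 2) ^ 3) =
      56 * (q 0 ^ 2 + q 1 ^ 2 + q 2 ^ 2) ^ 2 := by
  simp only [Fin.sum_univ_succ, Fin.sum_univ_zero, slots, Matrix.cons_val_zero, Matrix.cons_val_succ,
    Matrix.cons_val_one, Matrix.head_cons, Matrix.cons_val_two, Matrix.tail_cons]
  push_cast
  field_simp
  ring

/-- **S₆.** The degree-6 cubature moment of the 26 slots: `Σ_j τ_j (v_j·q)² (q·m_j)⁴ / (n_j |m_j|⁸) = 24 |q|⁶` for every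
`q` (not a consequence of `slotTerm_sum`; same `Fin 26` expansion). -/
theorem slots_sixthMoment_sum (q : EuclideanSpace ℝ (Fin 3)) :
    ∑ j, ((slots j).τ : ℝ) * (((slots j).v 0 : ℝ) * q 0 + (slots j).v 1 * q 1 + (slots j).v 2 * q 2) ^ 2 *
        (q 0 * (slots j).m 0 + q 1 * (slots j).m 1 + q 2 * (slots j).m 2) ^ 4 /
        ((slots j).n * (((slots j).m 0 : ℝ) ^ 2 + (slots j).m 1 ^ 2 + (slots j).m 2 ^ 2) ^ 4) =
      24 * (q 0 ^ 2 + q 1 ^ 2 + q 2 ^ 2) ^ 3 := by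
  simp only [Fin.sum_univ_succ, Fin.sum_univ_zero, slots, Matrix.cons_val_zero, Matrix.cons_val_succ,
    Matrix.cons_val_one, Matrix.head_cons, Matrix.cons_val_two, Matrix.tail_cons]
  push_cast
  field_simp
  ring

/-- The two specialisations of `slotTerm` behind `S₂`/`S₄` (per slot, any admissible data): at `p = 0` the slot term is the
`S₂`-summand over `32π⁴`, and at `p = q` it is the difference of the `S₂`- and `S₄`-summands over `32π⁴`. -/
theorem slotTerm_zero_and_self (d : SlotData) (h : d.ok) (q : EuclideanSpace ℝ (Fin 3)) :
    slotTerm d q 0 = (d.τ : ℝ) * ((d.v 0 : ℝ) * q 0 + d.v 1 * q 1 + d.v 2 * q 2) ^ 2 /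
        (d.n * ((d.m 0 : ℝ) ^ 2 + d.m 1 ^ 2 + d.m 2 ^ 2) ^ 2) / (32 * π ^ 4) ∧
    slotTerm d q q = ((d.τ : ℝ) * ((d.v 0 : ℝ) * q 0 + d.v 1 * q 1 + d.v 2 * q 2) ^ 2 /
        (d.n * ((d.m 0 : ℝ) ^ 2 + d.m 1 ^ 2 + d.m 2 ^ 2) ^ 2) -
      (d.τ : ℝ) * ((d.v 0 : ℝ) * q 0 + d.v 1 * q 1 + d.v 2 * q 2) ^ 2 *
        (q 0 * d.m 0 + q 1 * d.m 1 + q 2 * d.m 2) ^ 2 /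
        (d.n * ((d.m 0 : ℝ) ^ 2 + d.m 1 ^ 2 + d.m 2 ^ 2) ^ 3)) / (32 * π ^ 4) := by
  have hn : (0 : ℝ) < d.n := by exact_mod_cast h.2.1
  have hM : (0 : ℝ) < (d.m 0 : ℝ) ^ 2 + d.m 1 ^ 2 + d.m 2 ^ 2 := by
    rcases h.1 with h0 | h0 | h0
    · have : (d.m 0 : ℝ) ≠ 0 := by exact_mod_cast h0
      positivity
    · have : (d.m 1 : ℝ) ≠ 0 := by exact_mod_cast h0
      positivity
    · have : (d.m 2 : ℝ) ≠ 0 := by exact_mod_cast h0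
      positivity
  unfold slotTerm
  simp only [PiLp.zero_apply, zero_mul, add_zero, zero_pow two_ne_zero, sub_zero]
  constructor
  · field_simp
    ring
  · field_simp
    ring

/-! ## One good slot (pigeonhole) -/

/-- **One good slot, coordinates.** For every `q` some slot carries at least the average of `S₄`:
`∃ j, (28/13)|q|⁴ ≤ τ_j (v_j·q)² (q·m_j)² / (n_j |m_j|⁶)` (`56/26 = 28/13`; for `q = 0` both sides vanish). -/
theorem slots_exists_goodSlot (q : EuclideanSpace ℝ (Fin 3)) :
    ∃ j : Fin 26, 28 / 13 * (q 0 ^ 2 + q 1 ^ 2 + q 2 ^ 2) ^ 2 ≤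
      ((slots j).τ : ℝ) * (((slots j).v 0 : ℝ) * q 0 + (slots j).v 1 * q 1 + (slots j).v 2 * q 2) ^ 2 *
        (q 0 * (slots j).m 0 + q 1 * (slots j).m 1 + q 2 * (slots j).m 2) ^ 2 /
        ((slots j).n * (((slots j).m 0 : ℝ) ^ 2 + (slots j).m 1 ^ 2 + (slots j).m 2 ^ 2) ^ 3) := by
  have hsum := slots_fourthMoment_sum q
  have hconst : ∑ _j : Fin 26, 28 / 13 * (q 0 ^ 2 + q 1 ^ 2 + q 2 ^ 2) ^ 2 =
      56 * (q 0 ^ 2 + q 1 ^ 2 + q 2 ^ 2) ^ 2 := by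
    rw [Finset.sum_const, Finset.card_univ, Fintype.card_fin]
    ring
  obtain ⟨j, -, hj⟩ := Finset.exists_le_of_sum_le (Finset.univ_nonempty (α := Fin 26))
    (f := fun _ : Fin 26 => 28 / 13 * (q 0 ^ 2 + q 1 ^ 2 + q 2 ^ 2) ^ 2) (hconst.trans hsum.symm).le
  exact ⟨j, hj⟩

/-! ## The slot table and the word's phases -/

/-- Slot table facts (integer arithmetic, by `decide`): every slot has `|m_j|² ∈ {1,2,3}` with `τ_j = 40, 128, 243`
respectively (`τ_j = c_j |m_j|⁴`, `c = 40, 32, 27`), and `n_j = |v_j|² > 0`. -/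
theorem slots_table (j : Fin 26) :
    ((slots j).m 0 ^ 2 + (slots j).m 1 ^ 2 + (slots j).m 2 ^ 2 = 1 ∧ (slots j).τ = 40 ∨
      (slots j).m 0 ^ 2 + (slots j).m 1 ^ 2 + (slots j).m 2 ^ 2 = 2 ∧ (slots j).τ = 128 ∨
      (slots j).m 0 ^ 2 + (slots j).m 1 ^ 2 + (slots j).m 2 ^ 2 = 3 ∧ (slots j).τ = 243) ∧
    0 < (slots j).n ∧ (slots j).v 0 ^ 2 + (slots j).v 1 ^ 2 + (slots j).v 2 ^ 2 = ((slots j).n : ℤ) := by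
  revert j
  decide

/-- The phases of the cubature word are `mkPhase (slots j)`: direction `m_j`, polarisation `v_j/√n_j`, duration `τ_j`. -/
theorem cubatureWord_phase (j : Fin 26) :
    (cubatureWord.phase j).m = (slots j).m ∧
      (cubatureWord.phase j).e = (1 / Real.sqrt (slots j).n) • Torus.latticeVec (slots j).v ∧
      (cubatureWord.phase j).τ = ((slots j).τ : ℝ) :=
  ⟨rfl, rfl, rfl⟩

/-- `‖m_j‖²` in coordinates. -/
theorem cubatureWord_norm_m_sq (j : Fin 26) :
    ‖Torus.latticeVec (cubatureWord.phase j).m‖ ^ 2 =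
      ((slots j).m 0 : ℝ) ^ 2 + (slots j).m 1 ^ 2 + (slots j).m 2 ^ 2 := by
  rw [norm_sq_fin_three]
  simp only [Torus.latticeVec_apply]
  rfl

/-- `⟪m_j, q⟫` in coordinates. -/
theorem cubatureWord_inner_m (j : Fin 26) (q : EuclideanSpace ℝ (Fin 3)) :
    ⟪Torus.latticeVec (cubatureWord.phase j).m, q⟫_ℝ =
      q 0 * (slots j).m 0 + q 1 * (slots j).m 1 + q 2 * (slots j).m 2 := by
  rw [inner_fin_three]
  simp only [Torus.latticeVec_apply]
  show ((slots j).m 0 : ℝ) * q 0 + (slots j).m 1 * q 1 + (slots j).m 2 * q 2 = _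
  ring

/-- `⟪ê_j, q⟫²` in coordinates: `(v_j·q)²/n_j`. -/
theorem cubatureWord_inner_e_sq (j : Fin 26) (q : EuclideanSpace ℝ (Fin 3)) :
    ⟪(cubatureWord.phase j).e, q⟫_ℝ ^ 2 =
      (((slots j).v 0 : ℝ) * q 0 + (slots j).v 1 * q 1 + (slots j).v 2 * q 2) ^ 2 / (slots j).n := by
  have hn : (0 : ℝ) < (slots j).n := by exact_mod_cast (slots_table j).2.1
  rw [(cubatureWord_phase j).2.1, real_inner_smul_left, inner_fin_three]
  simp only [Torus.latticeVec_apply]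
  rw [mul_pow, one_div, inv_pow, Real.sq_sqrt hn.le, inv_mul_eq_div]

/-- The slot table in the word's language: `‖m_j‖² ∈ {1,2,3}` with `τ_j = 40‖m_j‖⁴, 32‖m_j‖⁴, 27‖m_j‖⁴`; hence
`1 ≤ ‖m_j‖² ≤ 3` and `27‖m_j‖⁴ ≤ τ_j ≤ 40‖m_j‖⁴`. -/
theorem cubatureWord_slot_bounds (j : Fin 26) :
    (‖Torus.latticeVec (cubatureWord.phase j).m‖ ^ 2 = 1 ∧ (cubatureWord.phase j).τ = 40 ∨
      ‖Torus.latticeVec (cubatureWord.phase j).m‖ ^ 2 = 2 ∧ (cubatureWord.phase j).τ = 128 ∨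
      ‖Torus.latticeVec (cubatureWord.phase j).m‖ ^ 2 = 3 ∧ (cubatureWord.phase j).τ = 243) ∧
    1 ≤ ‖Torus.latticeVec (cubatureWord.phase j).m‖ ^ 2 ∧ ‖Torus.latticeVec (cubatureWord.phase j).m‖ ^ 2 ≤ 3 ∧
    27 * (‖Torus.latticeVec (cubatureWord.phase j).m‖ ^ 2) ^ 2 ≤ (cubatureWord.phase j).τ ∧
    (cubatureWord.phase j).τ ≤ 40 * (‖Torus.latticeVec (cubatureWord.phase j).m‖ ^ 2) ^ 2 := by
  have hM := cubatureWord_norm_m_sq j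
  have hτ := (cubatureWord_phase j).2.2
  have hMZ : ‖Torus.latticeVec (cubatureWord.phase j).m‖ ^ 2 =
      (((slots j).m 0 ^ 2 + (slots j).m 1 ^ 2 + (slots j).m 2 ^ 2 : ℤ) : ℝ) := by
    rw [hM]; push_cast; ring
  rcases (slots_table j).1 with ⟨h1, h2⟩ | ⟨h1, h2⟩ | ⟨h1, h2⟩
  · have hA : ‖Torus.latticeVec (cubatureWord.phase j).m‖ ^ 2 = 1 := by rw [hMZ, h1]; norm_num
    have hB : (cubatureWord.phase j).τ = 40 := by rw [hτ, h2]; norm_num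
    refine ⟨Or.inl ⟨hA, hB⟩, ?_, ?_, ?_, ?_⟩ <;> rw [hA] <;> (try rw [hB]) <;> norm_num
  · have hA : ‖Torus.latticeVec (cubatureWord.phase j).m‖ ^ 2 = 2 := by rw [hMZ, h1]; norm_num
    have hB : (cubatureWord.phase j).τ = 128 := by rw [hτ, h2]; norm_num
    refine ⟨Or.inr (Or.inl ⟨hA, hB⟩), ?_, ?_, ?_, ?_⟩ <;> rw [hA] <;> (try rw [hB]) <;> norm_num
  · have hA : ‖Torus.latticeVec (cubatureWord.phase j).m‖ ^ 2 = 3 := by rw [hMZ, h1]; norm_num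
    have hB : (cubatureWord.phase j).τ = 243 := by rw [hτ, h2]; norm_num
    refine ⟨Or.inr (Or.inr ⟨hA, hB⟩), ?_, ?_, ?_, ?_⟩ <;> rw [hA] <;> (try rw [hB]) <;> norm_num

/-- `LatticeWord.stretch` rescales slot durations only: directions, polarisations, phase angles and the ramp are unchanged
(so every statement below about `cubatureWord.phase j` applies verbatim to the stretched replays
`(cubatureWord.stretch M hM).stretch (1/ν) _` of the K2R crux). -/
theorem LatticeWord_stretch_phase {k : ℕ} (W : LatticeWord k) (s : ℝ) (hs : 0 < s) (j : Fin k) :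
    ((W.stretch s hs).phase j).m = (W.phase j).m ∧ ((W.stretch s hs).phase j).e = (W.phase j).e ∧
      ((W.stretch s hs).phase j).φ = (W.phase j).φ ∧ ((W.stretch s hs).phase j).τ = s * (W.phase j).τ ∧
      (W.stretch s hs).ramp = W.ramp :=
  ⟨rfl, rfl, rfl, rfl, rfl⟩

/-- **One good slot, in the word's language.** For every large-scale wave-vector `q` there is a slot `j` of the cubature
word with `(28/13)‖q‖⁴‖m_j‖⁶ ≤ τ_j ⟪ê_j, q⟫² ⟪m_j, q⟫²` (the per-period energy bookkeeping of the far sectors uses it in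
exactly this form: `τ_j (q̂·ê_j)² (q̂·m̂_j)² ≥ (56/26)|m_j|⁴`), and consequently both angles are bounded away from `π/2`:
`(7/130)‖q‖² ≤ ⟪ê_j, q⟫²` and `(7/130)‖q‖²‖m_j‖² ≤ ⟪m_j, q⟫²` (`τ_j ≤ 40‖m_j‖⁴`, Cauchy–Schwarz on the other
factor; `√(7/130) ≈ 0.232`). -/
theorem cubatureWord_exists_goodPhase (q : EuclideanSpace ℝ (Fin 3)) :
    ∃ j : Fin 26,
      28 / 13 * ‖q‖ ^ 4 * (‖Torus.latticeVec (cubatureWord.phase j).m‖ ^ 2) ^ 3 ≤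
          (cubatureWord.phase j).τ * ⟪(cubatureWord.phase j).e, q⟫_ℝ ^ 2 *
            ⟪Torus.latticeVec (cubatureWord.phase j).m, q⟫_ℝ ^ 2 ∧
        7 / 130 * ‖q‖ ^ 2 ≤ ⟪(cubatureWord.phase j).e, q⟫_ℝ ^ 2 ∧
        7 / 130 * (‖q‖ ^ 2 * ‖Torus.latticeVec (cubatureWord.phase j).m‖ ^ 2) ≤
          ⟪Torus.latticeVec (cubatureWord.phase j).m, q⟫_ℝ ^ 2 := by
  obtain ⟨j, hj⟩ := slots_exists_goodSlot q
  refine ⟨j, ?_⟩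
  have hq : ‖q‖ ^ 2 = q 0 ^ 2 + q 1 ^ 2 + q 2 ^ 2 := norm_sq_fin_three q
  have hM := cubatureWord_norm_m_sq j
  have hτ := (cubatureWord_phase j).2.2
  have he := cubatureWord_inner_e_sq j q
  have hm := cubatureWord_inner_m j q
  obtain ⟨-, hM1, -, -, hτ40⟩ := cubatureWord_slot_bounds j
  have hn : (0 : ℝ) < (slots j).n := by exact_mod_cast (slots_table j).2.1
  have hMpos : 0 < ‖Torus.latticeVec (cubatureWord.phase j).m‖ ^ 2 := by linarith
  -- (1) the product bound, cleared of denominators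
  have h1 : 28 / 13 * ‖q‖ ^ 4 * (‖Torus.latticeVec (cubatureWord.phase j).m‖ ^ 2) ^ 3 ≤
      (cubatureWord.phase j).τ * ⟪(cubatureWord.phase j).e, q⟫_ℝ ^ 2 *
        ⟪Torus.latticeVec (cubatureWord.phase j).m, q⟫_ℝ ^ 2 := by
    rw [hτ, he, hm, hM, show ‖q‖ ^ 4 = (‖q‖ ^ 2) ^ 2 by ring, hq]
    rw [hM] at hMpos
    rw [le_div_iff₀ (by positivity)] at hj
    have : ((slots j).τ : ℝ) * ((((slots j).v 0 : ℝ) * q 0 + (slots j).v 1 * q 1 + (slots j).v 2 * q 2) ^ 2 /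
        (slots j).n) * (q 0 * (slots j).m 0 + q 1 * (slots j).m 1 + q 2 * (slots j).m 2) ^ 2 =
        ((slots j).τ : ℝ) * (((slots j).v 0 : ℝ) * q 0 + (slots j).v 1 * q 1 + (slots j).v 2 * q 2) ^ 2 *
        (q 0 * (slots j).m 0 + q 1 * (slots j).m 1 + q 2 * (slots j).m 2) ^ 2 / (slots j).n := by ring
    rw [this, le_div_iff₀ hn]
    calc 28 / 13 * (q 0 ^ 2 + q 1 ^ 2 + q 2 ^ 2) ^ 2 *
          (((slots j).m 0 : ℝ) ^ 2 + (slots j).m 1 ^ 2 + (slots j).m 2 ^ 2) ^ 3 * (slots j).n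
        = 28 / 13 * (q 0 ^ 2 + q 1 ^ 2 + q 2 ^ 2) ^ 2 *
          ((slots j).n * (((slots j).m 0 : ℝ) ^ 2 + (slots j).m 1 ^ 2 + (slots j).m 2 ^ 2) ^ 3) := by ring
      _ ≤ _ := hj
  -- Cauchy–Schwarz bounds on each factor
  have hCSe : ⟪(cubatureWord.phase j).e, q⟫_ℝ ^ 2 ≤ ‖q‖ ^ 2 := by
    have h := abs_real_inner_le_norm (cubatureWord.phase j).e q
    rw [(cubatureWord.phase j).e_unit, one_mul] at h
    rw [← sq_abs]
    exact pow_le_pow_left₀ (abs_nonneg _) h 2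
  have hCSm : ⟪Torus.latticeVec (cubatureWord.phase j).m, q⟫_ℝ ^ 2 ≤
      ‖Torus.latticeVec (cubatureWord.phase j).m‖ ^ 2 * ‖q‖ ^ 2 := by
    have h := abs_real_inner_le_norm (Torus.latticeVec (cubatureWord.phase j).m) q
    rw [← mul_pow, ← sq_abs]
    exact pow_le_pow_left₀ (abs_nonneg _) h 2
  have hprod : 7 / 130 * ‖q‖ ^ 4 * ‖Torus.latticeVec (cubatureWord.phase j).m‖ ^ 2 ≤
      ⟪(cubatureWord.phase j).e, q⟫_ℝ ^ 2 * ⟪Torus.latticeVec (cubatureWord.phase j).m, q⟫_ℝ ^ 2 := by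
    -- divide (1) by `40 ‖m_j‖⁴ ≥ τ_j`
    have h2 : (cubatureWord.phase j).τ * ⟪(cubatureWord.phase j).e, q⟫_ℝ ^ 2 *
        ⟪Torus.latticeVec (cubatureWord.phase j).m, q⟫_ℝ ^ 2 ≤
        40 * (‖Torus.latticeVec (cubatureWord.phase j).m‖ ^ 2) ^ 2 * (⟪(cubatureWord.phase j).e, q⟫_ℝ ^ 2 *
          ⟪Torus.latticeVec (cubatureWord.phase j).m, q⟫_ℝ ^ 2) := by
      rw [mul_assoc]
      exact mul_le_mul_of_nonneg_right hτ40 (by positivity)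
    have h3 := h1.trans h2
    have h4 : 40 * (‖Torus.latticeVec (cubatureWord.phase j).m‖ ^ 2) ^ 2 *
        (7 / 130 * ‖q‖ ^ 4 * ‖Torus.latticeVec (cubatureWord.phase j).m‖ ^ 2) =
        28 / 13 * ‖q‖ ^ 4 * (‖Torus.latticeVec (cubatureWord.phase j).m‖ ^ 2) ^ 3 := by ring
    rw [← h4] at h3
    exact le_of_mul_le_mul_left h3 (by positivity)
  refine ⟨h1, ?_, ?_⟩
  · -- use `⟪m_j, q⟫² ≤ ‖m_j‖²‖q‖²`
    by_cases hq0 : q = 0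
    · subst hq0; simp
    have hqpos : 0 < ‖q‖ ^ 2 := by positivity
    have h5 : 7 / 130 * ‖q‖ ^ 4 * ‖Torus.latticeVec (cubatureWord.phase j).m‖ ^ 2 ≤
        ⟪(cubatureWord.phase j).e, q⟫_ℝ ^ 2 * (‖Torus.latticeVec (cubatureWord.phase j).m‖ ^ 2 * ‖q‖ ^ 2) :=
      hprod.trans (mul_le_mul_of_nonneg_left hCSm (sq_nonneg _))
    have h6 : (7 / 130 * ‖q‖ ^ 2) * (‖Torus.latticeVec (cubatureWord.phase j).m‖ ^ 2 * ‖q‖ ^ 2) ≤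
        ⟪(cubatureWord.phase j).e, q⟫_ℝ ^ 2 * (‖Torus.latticeVec (cubatureWord.phase j).m‖ ^ 2 * ‖q‖ ^ 2) := by
      calc (7 / 130 * ‖q‖ ^ 2) * (‖Torus.latticeVec (cubatureWord.phase j).m‖ ^ 2 * ‖q‖ ^ 2)
          = 7 / 130 * ‖q‖ ^ 4 * ‖Torus.latticeVec (cubatureWord.phase j).m‖ ^ 2 := by ring
        _ ≤ _ := h5
    exact le_of_mul_le_mul_right h6 (by positivity)
  · -- use `⟪ê_j, q⟫² ≤ ‖q‖²`
    by_cases hq0 : q = 0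
    · subst hq0; simp
    have hqpos : 0 < ‖q‖ ^ 2 := by positivity
    have h5 : 7 / 130 * ‖q‖ ^ 4 * ‖Torus.latticeVec (cubatureWord.phase j).m‖ ^ 2 ≤
        ‖q‖ ^ 2 * ⟪Torus.latticeVec (cubatureWord.phase j).m, q⟫_ℝ ^ 2 :=
      hprod.trans (mul_le_mul_of_nonneg_right hCSe (sq_nonneg _))
    have h6 : ‖q‖ ^ 2 * (7 / 130 * (‖q‖ ^ 2 * ‖Torus.latticeVec (cubatureWord.phase j).m‖ ^ 2)) ≤
        ‖q‖ ^ 2 * ⟪Torus.latticeVec (cubatureWord.phase j).m, q⟫_ℝ ^ 2 := by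
      calc ‖q‖ ^ 2 * (7 / 130 * (‖q‖ ^ 2 * ‖Torus.latticeVec (cubatureWord.phase j).m‖ ^ 2))
          = 7 / 130 * ‖q‖ ^ 4 * ‖Torus.latticeVec (cubatureWord.phase j).m‖ ^ 2 := by ring
        _ ≤ _ := h5
    exact le_of_mul_le_mul_left h6 hqpos

end

end Summit.AnomalousDissipation.AnomalousDissipation.Theorems
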